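import Mathlib.Probability.Independence.Integration
import Mathlib.MeasureTheory.Function.L2Space
import Mathlib.Algebra.Order.Chebyshev
import HarnessLib

/-!
# Sums of independent random vectors grow like `√m`: Micciancio–Regev 2007, Lemma 2.11

Topic `Probability/Moments`. A fully PROVED second-moment bound for weighted sums of independent
random vectors in a real inner product space (Micciancio–Regev, *Worst-case to average-case
reductions based on Gaussian measures*, SIAM J. Comput. 37 (2007), Lemma 2.11, p. 10 of the
authors' version): if `v₁, …, v_m` are independent random vectors with `E‖vᵢ‖² ≤ l` and
`‖E vᵢ‖² ≤ ε`, then for every `z ∈ ℝᵐ`, `E‖∑ᵢ zᵢ vᵢ‖² ≤ (l + ε m) ‖z‖²`. This is the last step of the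
proofs of MR07 Thm. 5.9 (p. 24) and Thm. 5.23 (p. 31, eq. (20) ff.), where the `vᵢ` are (coordinates
of) discrete Gaussian samples; it is recorded here in Mathlib's language (`iIndepFun`, Bochner
expectations) independently of lattices.

## Results

* `integral_inner_eq_inner_integral_of_indepFun` — for independent integrable random vectors,
  `E⟪X, Y⟫ = ⟪E X, E Y⟫` (Mathlib's `IndepFun.integral_bilin` with `B = innerSL ℝ`).
* `sum_sum_mul_mul_le_of_inner` — the deterministic half of the printed proof: if `a i i ≤ l`,
  `a i j = ⟪μᵢ, μⱼ⟫` for `i ≠ j` and `‖μᵢ‖² ≤ ε`, then `∑ᵢ ∑ⱼ zᵢ zⱼ a i j ≤ (l + ε m) ∑ᵢ zᵢ²`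
  ("`∑ᵢ |zᵢ| ≤ √m ‖z‖`").
* `MicciancioRegev2007.integral_norm_sq_sum_smul_le` — **MR07 Lemma 2.11**.

## References

* D. Micciancio, O. Regev, *Worst-case to average-case reductions based on Gaussian measures*,
  SIAM J. Comput. 37 (2007) 267–302, Lemma 2.11 (p. 10 of the authors' version,
  `lit read doi:10.1137/S0097539705447360`).
-/

noncomputable section

open MeasureTheory ProbabilityTheory Finset
open scoped InnerProductSpace

namespace Literature.Probability.Moments

section Deterministic

variable {F : Type*} [NormedAddCommGroup F] [InnerProductSpace ℝ F]

/-- **The deterministic half of MR07 Lemma 2.11** (p. 10: "`∑_{i,j} zᵢ zⱼ E⟨vᵢ, vⱼ⟩ =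
∑ᵢ zᵢ² E‖vᵢ‖² + ∑_{i ≠ j} zᵢ zⱼ ⟨E vᵢ, E vⱼ⟩ ≤ ‖z‖² l + (∑ᵢ |zᵢ| √ε)² ≤ ‖z‖²(l + ε m)`", using
`∑ᵢ |zᵢ| ≤ √m ‖z‖`): for a real matrix `a` with `a i i ≤ l` and `a i j = ⟪μᵢ, μⱼ⟫` (`i ≠ j`), where
`‖μᵢ‖² ≤ ε`, one has `∑ᵢ ∑ⱼ zᵢ zⱼ a i j ≤ (l + ε m) ∑ᵢ zᵢ²`.
[cite: MicciancioRegev2007, Lemma 2.11 (proof, p. 10)] -/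
theorem sum_sum_mul_mul_le_of_inner {m : ℕ} (a : Fin m → Fin m → ℝ) (μv : Fin m → F) {l ε : ℝ}
    (hdiag : ∀ i, a i i ≤ l) (hoff : ∀ i j, i ≠ j → a i j = ⟪μv i, μv j⟫_ℝ) (hμ : ∀ i, ‖μv i‖ ^ 2 ≤ ε)
    (z : Fin m → ℝ) :
    ∑ i, ∑ j, z i * z j * a i j ≤ (l + ε * m) * ∑ i, z i ^ 2 := by
  -- `a i j = ⟪μᵢ, μⱼ⟫ + [i = j] (a i i - ‖μᵢ‖²)`
  have hsplit : ∀ i j, z i * z j * a i j =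
      z i * z j * ⟪μv i, μv j⟫_ℝ + (if i = j then z i ^ 2 * (a i i - ‖μv i‖ ^ 2) else 0) := by
    intro i j
    by_cases hij : i = j
    · subst hij
      rw [if_pos rfl, real_inner_self_eq_norm_sq]
      ring
    · rw [if_neg hij, hoff i j hij, add_zero]
  have hgram : ∑ i, ∑ j, z i * z j * ⟪μv i, μv j⟫_ℝ = ‖∑ i, z i • μv i‖ ^ 2 := by
    rw [← real_inner_self_eq_norm_sq, sum_inner]
    refine sum_congr rfl fun i _ ↦ ?_
    rw [inner_sum]
    refine sum_congr rfl fun j _ ↦ ?_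
    rw [real_inner_smul_left, real_inner_smul_right]
    ring
  rcases Nat.eq_zero_or_pos m with rfl | hm
  · simp
  have hε0 : 0 ≤ ε := (sq_nonneg _).trans (hμ ⟨0, hm⟩)
  have hstep1 : ∑ i, ∑ j, z i * z j * a i j =
      ‖∑ i, z i • μv i‖ ^ 2 + ∑ i, z i ^ 2 * (a i i - ‖μv i‖ ^ 2) := by
    rw [← hgram, ← sum_add_distrib]
    refine sum_congr rfl fun i _ ↦ ?_
    simp_rw [hsplit i]
    rw [sum_add_distrib, sum_ite_eq]
    simp
  have hnorm : ‖∑ i, z i • μv i‖ ≤ ∑ i, |z i| * ‖μv i‖ := by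
    refine (norm_sum_le _ _).trans (le_of_eq (sum_congr rfl fun i _ ↦ ?_))
    rw [norm_smul, Real.norm_eq_abs]
  have habs : ∀ i, |z i| * ‖μv i‖ ≤ |z i| * Real.sqrt ε := fun i ↦
    mul_le_mul_of_nonneg_left ((abs_of_nonneg (norm_nonneg _)).symm.trans_le (Real.abs_le_sqrt (hμ i)))
      (abs_nonneg _)
  have hsum0 : 0 ≤ ∑ i, |z i| * ‖μv i‖ := sum_nonneg fun i _ ↦ by positivity
  have hCS : (∑ i : Fin m, |z i|) ^ 2 ≤ m * ∑ i, z i ^ 2 := by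
    have h := sq_sum_le_card_mul_sum_sq (s := (univ : Finset (Fin m))) (f := fun i ↦ |z i|)
    simp only [card_univ, Fintype.card_fin, sq_abs] at h
    exact h
  calc ∑ i, ∑ j, z i * z j * a i j
      = ‖∑ i, z i • μv i‖ ^ 2 + ∑ i, z i ^ 2 * (a i i - ‖μv i‖ ^ 2) := hstep1
    _ ≤ (∑ i, |z i| * ‖μv i‖) ^ 2 + ∑ i, z i ^ 2 * l :=
        add_le_add (pow_le_pow_left₀ (norm_nonneg _) hnorm 2) (sum_le_sum fun i _ ↦
          mul_le_mul_of_nonneg_left (by nlinarith [hdiag i, sq_nonneg ‖μv i‖]) (sq_nonneg _))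
    _ ≤ (∑ i, |z i| * Real.sqrt ε) ^ 2 + ∑ i, z i ^ 2 * l :=
        add_le_add (pow_le_pow_left₀ hsum0 (sum_le_sum fun i _ ↦ habs i) 2) le_rfl
    _ = ε * (∑ i, |z i|) ^ 2 + l * ∑ i, z i ^ 2 := by
        rw [← sum_mul, mul_pow, Real.sq_sqrt hε0, ← sum_mul]
        ring
    _ ≤ ε * (m * ∑ i, z i ^ 2) + l * ∑ i, z i ^ 2 := by gcongr
    _ = (l + ε * m) * ∑ i, z i ^ 2 := by ring

end Deterministic

section Random

variable {Ω : Type*} [MeasurableSpace Ω] {P : Measure Ω} [IsProbabilityMeasure P]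
variable {F : Type*} [NormedAddCommGroup F] [InnerProductSpace ℝ F] [CompleteSpace F]
  [MeasurableSpace F] [BorelSpace F]

omit [IsProbabilityMeasure P] in
/-- **Expectation of the pairing of independent random vectors** (Micciancio–Regev 2007, proof of
Lemma 2.11, p. 10: "`E[⟨vᵢ, vⱼ⟩] = ⟨E vᵢ, E vⱼ⟩` for `i ≠ j`"): for independent integrable random vectors
`X, Y` in a real Hilbert space, `E⟪X, Y⟫ = ⟪E X, E Y⟫` (Mathlib's `IndepFun.integral_bilin` with the
continuous bilinear map `innerSL ℝ`). [cite: MicciancioRegev2007, Lemma 2.11 (proof, p. 10)] -/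
theorem integral_inner_eq_inner_integral_of_indepFun {X Y : Ω → F} (hXY : IndepFun X Y P)
    (hX : Integrable X P) (hY : Integrable Y P) :
    ∫ ω, ⟪X ω, Y ω⟫_ℝ ∂P = ⟪∫ ω, X ω ∂P, ∫ ω, Y ω ∂P⟫_ℝ := by
  exact hXY.integral_bilin hX hY (innerSL ℝ : F →L[ℝ] F →L[ℝ] ℝ)

/-- **Micciancio–Regev 2007, Lemma 2.11** (p. 10): let `v₁, …, v_m` be independent random vectors in a
real Hilbert space with `E‖vᵢ‖² ≤ l` and `‖E vᵢ‖² ≤ ε` for every `i`. Then for every `z ∈ ℝᵐ`,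
`E‖∑ᵢ zᵢ vᵢ‖² ≤ (l + ε m) ‖z‖²` (here `‖z‖² = ∑ᵢ zᵢ²`). Hypotheses as printed: independence
(`iIndepFun`; only pairwise independence is used), square-integrability (tacit in print), the two
moment bounds. Proof as printed: `E‖∑ zᵢvᵢ‖² = ∑_{i,j} zᵢzⱼ E⟨vᵢ, vⱼ⟩`, `E⟨vᵢ, vⱼ⟩ = ⟨Evᵢ, Evⱼ⟩` for
`i ≠ j`, and `sum_sum_mul_mul_le_of_inner`. [cite: MicciancioRegev2007, Lemma 2.11] -/
theorem MicciancioRegev2007.integral_norm_sq_sum_smul_le {m : ℕ} {V : Fin m → Ω → F}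
    (hind : iIndepFun V P) (hL2 : ∀ i, MemLp (V i) 2 P) {l ε : ℝ}
    (hl : ∀ i, ∫ ω, ‖V i ω‖ ^ 2 ∂P ≤ l) (hε : ∀ i, ‖∫ ω, V i ω ∂P‖ ^ 2 ≤ ε) (z : Fin m → ℝ) :
    ∫ ω, ‖∑ i, z i • V i ω‖ ^ 2 ∂P ≤ (l + ε * m) * ∑ i, z i ^ 2 := by
  -- integrability of the pairings `⟪Vᵢ, Vⱼ⟫` (Hölder)
  have hint : ∀ i j, Integrable (fun ω ↦ ⟪V i ω, V j ω⟫_ℝ) P := fun i j ↦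
    ((hL2 i).norm.integrable_mul (hL2 j).norm).mono' ((hL2 i).1.inner (hL2 j).1)
      (ae_of_all _ fun ω ↦ norm_inner_le_norm (V i ω) (V j ω))
  -- pointwise expansion of the squared norm
  have hexp : ∀ ω, ‖∑ i, z i • V i ω‖ ^ 2 = ∑ i, ∑ j, z i * z j * ⟪V i ω, V j ω⟫_ℝ := by
    intro ω
    rw [← real_inner_self_eq_norm_sq, sum_inner]
    refine sum_congr rfl fun i _ ↦ ?_
    rw [inner_sum]
    refine sum_congr rfl fun j _ ↦ ?_
    rw [real_inner_smul_left, real_inner_smul_right]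
    ring
  -- integrate termwise
  have hI : ∫ ω, ‖∑ i, z i • V i ω‖ ^ 2 ∂P = ∑ i, ∑ j, z i * z j * ∫ ω, ⟪V i ω, V j ω⟫_ℝ ∂P := by
    simp_rw [hexp]
    rw [integral_finsetSum _ (fun i _ ↦ integrable_finsetSum _ fun j _ ↦ (hint i j).const_mul _)]
    refine sum_congr rfl fun i _ ↦ ?_
    rw [integral_finsetSum _ (fun j _ ↦ (hint i j).const_mul _)]
    refine sum_congr rfl fun j _ ↦ ?_
    rw [integral_const_mul]
  rw [hI]
  refine sum_sum_mul_mul_le_of_inner (fun i j ↦ ∫ ω, ⟪V i ω, V j ω⟫_ℝ ∂P) (fun i ↦ ∫ ω, V i ω ∂P)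
    (fun i ↦ ?_) (fun i j hij ↦ ?_) hε z
  · simp_rw [real_inner_self_eq_norm_sq]
    exact hl i
  · exact integral_inner_eq_inner_integral_of_indepFun (hind.indepFun hij)
      ((hL2 i).integrable one_le_two) ((hL2 j).integrable one_le_two)

end Random

end Literature.Probability.Moments

end
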